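import Literature.Topology.FourManifolds.StableNormalFrameRank
import Literature.Topology.FourManifolds.Spin
import Mathlib.Geometry.Manifold.ContMDiffMFDeriv
import Mathlib.Geometry.Manifold.PartitionOfUnity
import HarnessLib

/-!
# A smooth transverse normal frame for a stabilised immersion of an s-parallelisable manifold

Kervaire–Milnor, *Groups of homotopy spheres I* (1963), proof of Thm. 3.1 p. 508, in the form
needed for the framed tube of a compact s-parallelisable manifold WITH BOUNDARY: let `M` be a
compact `C^∞` manifold over any real model with corners `I` (model vector space `E`), `f : M → V`
a smooth immersion into a finite-dimensional inner product space (injective `mfderiv`), and let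
`M` be s-parallelisable (`IsStablyParallelizable I M`, `Spin.lean`: a CONTINUOUS frame
`sⱼ = (uⱼ, rⱼ)` of `TM ⊕ ℝ`). Then the stabilised immersion `w ↦ (f w, 0) ∈ V × ℝ^κ`
(`κ = Fin (dim E + 1)`) admits a SMOOTH normal frame `νₖ : M → V × ℝ^κ`, `k : Fin (dim V + 1)`,
TRANSVERSE at every point:

  `(v, σ) ↦ (df_w v, 0) + ∑ₖ σₖ νₖ(w)` is injective on `T_wM × ℝ^{dim V + 1}`

(**`exists_smooth_transverse_normalFrame`**). Proof: push the stable frame forward,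
`tⱼ(w) = df_w (uⱼ w)` — continuous in `w` through the tangent map (`continuous_pushFrame`) —, form
the explicit continuous frame `ν⁰ₖ(w) = normalVec (t w) (r w) bₖ μₖ` of
`StableNormalFrameLinAlg.lean` over a basis `(bₖ, μₖ)` of `V × ℝ`, whose frame map has full rank
(`StableNormalFrameRank.lean`); full rank is uniformly stable on the compact `M`, so the smooth
approximation `ν` of `ν⁰` given by smooth partitions of unity
(`exists_contMDiffMap_forall_mem_convex_of_local`) still has full rank, and full rank implies
transversality (`injective_tubeDeriv_of_surjective_frameMap`).

Everything is proved; no named facts.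

## References

* M. Kervaire, J. Milnor, *Groups of homotopy spheres I*, Ann. of Math. 77 (1963), §3 proof of
  Thm. 3.1 p. 508. [KervaireMilnorAnnals1963]
* M. W. Hirsch, *Differential Topology*, GTM 33, Springer 1976, Ch. 4 §5–6. [Hirsch1976]
-/

noncomputable section

open scoped Manifold ContDiff RealInnerProductSpace
open Set Function Bundle Finset Metric Module

namespace Literature.Topology.FourManifolds

namespace StableNormalFrame

variable {E H : Type*} [NormedAddCommGroup E] [NormedSpace ℝ E] [FiniteDimensional ℝ E]
  [TopologicalSpace H] {I : ModelWithCorners ℝ E H}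
  {M : Type*} [TopologicalSpace M] [ChartedSpace H M] [IsManifold I ∞ M]
  {V : Type*} [NormedAddCommGroup V] [InnerProductSpace ℝ V] [FiniteDimensional ℝ V]

/-! ### The pushed-forward stable frame is continuous -/

omit [FiniteDimensional ℝ E] [FiniteDimensional ℝ V] in
/-- **The push-forward `w ↦ df_w (u w)` of a continuous tangent field along a smooth map into a
vector space is continuous** (through the continuous tangent map and the trivial tangent bundle
of the target). [folklore] -/
theorem continuous_pushFrame {f : M → V} (hf : ContMDiff I 𝓘(ℝ, V) ∞ f) {u : M → E}
    (hu : Continuous fun w => (TotalSpace.mk' E w (u w) : TangentBundle I M)) :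
    Continuous fun w => mfderiv I 𝓘(ℝ, V) f w (u w) := by
  have h1 : Continuous (tangentMap I 𝓘(ℝ, V) f) := hf.continuous_tangentMap (by simp)
  have h2 : Continuous fun q : TangentBundle 𝓘(ℝ, V) V =>
      (tangentBundleModelSpaceHomeomorph 𝓘(ℝ, V) q).2 :=
    continuous_snd.comp (tangentBundleModelSpaceHomeomorph 𝓘(ℝ, V)).continuous
  exact h2.comp (h1.comp hu)

/-! ### The main construction -/

/-- **A smooth transverse normal frame of the stabilised immersion of a compact s-parallelisable
manifold** (Kervaire–Milnor 1963, proof of Thm. 3.1): see the module docstring.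
[cite: KervaireMilnorAnnals1963, §3 proof of Thm. 3.1] -/
theorem exists_smooth_transverse_normalFrame [T2Space M] [CompactSpace M] {f : M → V}
    (hf : ContMDiff I 𝓘(ℝ, V) ∞ f) (hinj : ∀ w, Injective (mfderiv I 𝓘(ℝ, V) f w))
    (hfr : IsStablyParallelizable I M) :
    ∃ ν : Fin (finrank ℝ V + 1) → M → V × (Fin (finrank ℝ E + 1) → ℝ),
      (∀ k, ContMDiff I 𝓘(ℝ, V × (Fin (finrank ℝ E + 1) → ℝ)) ∞ (ν k)) ∧
      ∀ w, Injective fun p : E × (Fin (finrank ℝ V + 1) → ℝ) =>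
        ((mfderiv I 𝓘(ℝ, V) f w p.1, 0) : V × (Fin (finrank ℝ E + 1) → ℝ)) + ∑ k, p.2 k • ν k w := by
  classical
  -- the stable tangent frame
  obtain ⟨s, hs1, hs2, hsli⟩ := hfr
  -- the differential as a map of vector spaces `E →L V`
  let φ : M → E →L[ℝ] V := fun w => mfderiv I 𝓘(ℝ, V) f w
  have hφinj : ∀ w, Injective (φ w) := fun w => hinj w
  -- the pushed-forward frame `t j w = df (u_j w)`, `r j w`
  set t : M → Fin (finrank ℝ E + 1) → V := fun w j => φ w (s j w).1 with htdef
  set r : M → Fin (finrank ℝ E + 1) → ℝ := fun w j => (s j w).2 with hrdef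
  have ht : ∀ j, Continuous fun w => t w j := fun j => continuous_pushFrame hf (hs1 j)
  have hr : ∀ j, Continuous fun w => r w j := fun j => hs2 j
  -- linearity on sums
  have hφsum : ∀ (w : M) (c : Fin (finrank ℝ E + 1) → ℝ),
      ∑ j, c j • t w j = φ w (∑ j, c j • (s j w).1) := by
    intro w c
    rw [map_sum]
    refine Finset.sum_congr rfl fun j _ => ?_
    rw [map_smul]
  -- `(t, r)` is linearly independent at every point
  have hL : ∀ w, LinearIndependent ℝ fun j => ((t w j, r w j) : V × ℝ) := by
    intro w
    let L : (E × ℝ) →ₗ[ℝ] V × ℝ := ((φ w).toLinearMap).prodMap LinearMap.id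
    have hLk : LinearMap.ker L = ⊥ := by
      rw [LinearMap.ker_eq_bot]
      rintro ⟨v, a⟩ ⟨v', a'⟩ h
      have h' : (φ w v, a) = (φ w v', a') := h
      rw [Prod.mk.injEq] at h'
      exact Prod.ext (hφinj w h'.1) h'.2
    exact (hsli w).map' L hLk
  have hdet : ∀ w, IsUnit (gram (t w) (r w)).det := fun w => isUnit_det_gram (hL w)
  have hdet' : ∀ w, (gram (t w) (r w)).det ≠ 0 := fun w => (hdet w).ne_zero
  -- `s · w` is a basis of `E × ℝ`
  have hcardκ : Fintype.card (Fin (finrank ℝ E + 1)) = finrank ℝ (E × ℝ) := by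
    rw [Fintype.card_fin, Module.finrank_prod, Module.finrank_self]
  let bs : ∀ w, Basis (Fin (finrank ℝ E + 1)) ℝ (E × ℝ) := fun w =>
    basisOfLinearIndependentOfCardEqFinrank (hsli w) hcardκ
  have hbs : ∀ w j, bs w j = s j w := fun w j => by
    change (basisOfLinearIndependentOfCardEqFinrank (hsli w) hcardκ) j = s j w
    rw [coe_basisOfLinearIndependentOfCardEqFinrank]
  have hrepr : ∀ (w : M) (x : E × ℝ), ∑ j, (bs w).repr x j • s j w = x := fun w x => by
    have := (bs w).sum_repr x
    simpa only [hbs] using this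
  -- the unit vertical vector `(0, 1)` lies in the span
  have hvert : ∀ w, UnitVertical (t w) (r w) := by
    intro w
    have hsum := hrepr w ((0, 1) : E × ℝ)
    refine ⟨(bs w).repr ((0, 1) : E × ℝ), ?_, ?_⟩
    · have h1 : ∑ j, (bs w).repr ((0, 1) : E × ℝ) j • (s j w).1 = 0 := by
        have := congrArg Prod.fst hsum
        rw [Prod.fst_sum] at this
        simpa using this
      change ∑ j, (bs w).repr ((0, 1) : E × ℝ) j • t w j = 0
      rw [hφsum, h1, map_zero]
    · have := congrArg Prod.snd hsum
      rw [Prod.snd_sum] at this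
      simpa [smul_eq_mul] using this
  -- a nontrivial relation among the `t j w` (`d + 1` vectors in the `d`-dimensional `range df`)
  have hrel : ∀ w, ∃ α₀ : Fin (finrank ℝ E + 1) → ℝ, α₀ ≠ 0 ∧ ∑ j, α₀ j • t w j = 0 := by
    intro w
    have hnot : ¬ LinearIndependent ℝ fun j => (s j w).1 := by
      intro hli
      have := hli.fintype_card_le_finrank
      rw [Fintype.card_fin] at this
      omega
    obtain ⟨g, hg, i, hi⟩ := Fintype.not_linearIndependent_iff.1 hnot
    refine ⟨g, fun h => hi (by rw [h]; rfl), ?_⟩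
    rw [hφsum, hg, map_zero]
  -- the range of `df_w` is spanned by the `t j w`
  have hrange : ∀ (w : M) (v : E), φ w v ∈ Submodule.span ℝ (Set.range (t w)) := by
    intro w v
    have hv : ∑ j, (bs w).repr ((v, 0) : E × ℝ) j • (s j w).1 = v := by
      have := congrArg Prod.fst (hrepr w ((v, 0) : E × ℝ))
      rw [Prod.fst_sum] at this
      simpa using this
    rw [← hv, ← hφsum]
    exact Submodule.sum_mem _ fun j _ =>
      Submodule.smul_mem _ _ (Submodule.subset_span ⟨j, rfl⟩)
  -- a basis `(b k, μ k)` of `V × ℝ` indexed by `Fin (dim V + 1)`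
  have hKeq : finrank ℝ (V × ℝ) = finrank ℝ V + 1 := by
    rw [Module.finrank_prod, Module.finrank_self]
  let bK : Basis (Fin (finrank ℝ V + 1)) ℝ (V × ℝ) :=
    (Module.finBasis ℝ (V × ℝ)).reindex (finCongr hKeq)
  let b : Fin (finrank ℝ V + 1) → V := fun k => (bK k).1
  let μ : Fin (finrank ℝ V + 1) → ℝ := fun k => (bK k).2
  have hspan : ∀ (b' : V) (μ' : ℝ), ∃ σ : Fin (finrank ℝ V + 1) → ℝ,
      (∑ k, σ k • b k) = b' ∧ (∑ k, σ k * μ k) = μ' := by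
    intro b' μ'
    refine ⟨bK.repr (b', μ'), ?_, ?_⟩
    · have := congrArg Prod.fst (bK.sum_repr (b', μ'))
      rw [Prod.fst_sum] at this
      simpa using this
    · have := congrArg Prod.snd (bK.sum_repr (b', μ'))
      rw [Prod.snd_sum] at this
      simpa [smul_eq_mul] using this
  have hcard : Fintype.card (Fin (finrank ℝ V + 1)) = finrank ℝ V + 1 := Fintype.card_fin _
  -- the explicit continuous normal frame and its full rank
  let ν₀ : Fin (finrank ℝ V + 1) → M → V × (Fin (finrank ℝ E + 1) → ℝ) :=
    fun k w => normalVec (t w) (r w) (b k) (μ k)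
  have hν₀c : ∀ k, Continuous (ν₀ k) := fun k => continuous_normalVec ht hr hdet' (b k) (μ k)
  have hsurj₀ : ∀ w, Surjective (frameMapL (t w) fun k => ν₀ k w) := fun w =>
    surjective_frameMap_normalVec (hdet w) (hvert w) hspan
  have hΞc : Continuous fun w => frameMapL (t w) fun k => ν₀ k w :=
    continuous_frameMapL ht (fun k => hν₀c k)
  obtain ⟨δ, hδ, hstab⟩ := exists_forall_norm_sub_lt_surjective hΞc hsurj₀
  -- smooth approximation of the frame
  set δ' : ℝ := δ / (finrank ℝ V + 1 + 1) with hδ'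
  have hδ'pos : 0 < δ' := by positivity
  have happrox : ∀ k, ∃ g : C^∞⟮I, M; 𝓘(ℝ, V × (Fin (finrank ℝ E + 1) → ℝ)),
      V × (Fin (finrank ℝ E + 1) → ℝ)⟯, ∀ w, g w ∈ ball (ν₀ k w) δ' := by
    intro k
    refine exists_contMDiffMap_forall_mem_convex_of_local (I := I) (fun w => convex_ball _ _)
      fun w => ?_
    refine ⟨(ν₀ k) ⁻¹' ball (ν₀ k w) (δ' / 2), (hν₀c k).continuousAt.preimage_mem_nhds
      (ball_mem_nhds _ (by positivity)), fun _ => ν₀ k w, contMDiffOn_const, fun y hy => ?_⟩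
    rw [mem_ball, dist_comm]
    exact lt_of_lt_of_le (mem_ball.1 hy) (by linarith)
  choose g hg using happrox
  refine ⟨fun k w => g k w, fun k => (g k).contMDiff, fun w => ?_⟩
  -- full rank of the approximating frame at `w`
  have hdist : ‖(frameMapL (t w) fun k => g k w) - frameMapL (t w) fun k => ν₀ k w‖ < δ := by
    refine lt_of_le_of_lt (norm_frameMapL_sub_le (t w) (fun k => ν₀ k w) fun k => g k w) ?_
    calc ∑ k, ‖g k w - ν₀ k w‖ ≤ ∑ _k : Fin (finrank ℝ V + 1), δ' := by
          refine Finset.sum_le_sum fun k _ => ?_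
          have := hg k w
          rw [mem_ball, dist_eq_norm] at this
          exact this.le
      _ = (finrank ℝ V + 1) * δ' := by
          rw [Finset.sum_const, Finset.card_univ, Fintype.card_fin, nsmul_eq_mul]; push_cast; ring
      _ < δ := by
          rw [hδ', ← mul_div_assoc, div_lt_iff₀ (by positivity)]
          nlinarith
  have hsurj : Surjective (frameMap (t w) fun k => g k w) := hstab w _ hdist
  -- transversality by the dimension count
  exact injective_tubeDeriv_of_surjective_frameMap (φ w).toLinearMap (hφinj w) (hrange w) (hrel w)
    hcard hsurj

end StableNormalFrame

end Literature.Topology.FourManifolds
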